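import Summits.NavierStokesRegularity.FunctionalMining.TopEigSelectionBound
import Summits.NavierStokesRegularity.FunctionalMining.TopEigHeatCoerciveGap
import Literature.Analysis.FluidPDE.ParabolicComparison
import HarnessLib

/-!
# FunctionalMining/NoGo — POINTWISE HEAT-STATIONARITY: the Danskin sign rules that every EXACT
# (F2) witness must obey, and the melting of the top of `λ₁`

search for candidate a priori estimates; no regularity claim. Cell `pub-nsfunc`, NO-GO seat
(gen 50, touch 6). Problem side only (`Summits/…/FunctionalMining/NoGo/`); nothing here is a cited
result and nothing here decides the node `L-λ(q)` (`TopEigHeatCoercivePos q`, OPEN for every real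
`q > 1`).

## Context

Door (b) of the NO-GO branch is the WANTED kernel negation `¬ TopEigHeatCoercivePos q` ((F2)).
The finite-dimensional alternative (`NoGo/TopEigHeatFiniteDim`, staged K46) reduces every finite
design for (F2) to the hunt for an EXACT witness: a smooth divergence-free zero-mean field `v` on
`T³` with `Φ_q(v) = ∫(λ₁⁺)^q > 0` and `heatDissipation Φ_q v = 0`. The tree's Danskin formula
(`TopEig.heatDissipation_topEigMoment_eq_integral`, file `TopEigHeatDanskin`) writes the
dissipation of a smooth divergence-free field as
`heatDissipation Φ_q v = − ∫ q λ₁(x)^{q−1} μ(S(x); ΔS(x)) dx`, `μ(A; M) = max {eᵀMe : e ∈ E(A)}`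
(`TopEig.dirTopEig`; `E(A)` = the unit top eigenvectors, `TopEig.topEigSet`). This file turns the
formula into typed SIGN RULES for the exact-witness hunt.

## What is proved (all kernel-checked, no `sorry`)

* § 1–2 **Pointwise heat-stationarity forces zero dissipation.** If `μ(S(x); ΔS(x)) ≥ 0` at every
  point where `λ₁(x) > 0` (for `q = 1`: at every point), then `heatDissipation Φ_q v ≤ 0` on `T^d`,
  hence `= 0` on `T³` (`heatDissipation_topEigMoment_eq_zero_of_dirTopEig_nonneg_on_pos`; the
  tree's admissibility gives `≥ 0`). A usable test: ONE top eigenvector `e` with `eᵀ ΔS(x) e ≥ 0`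
  suffices at each point (`dirTopEig_nonneg_of_exists`).
* § 3 **One stationary field kills the whole node family.** The hypothesis is `q`-free: a single
  smooth divergence-free zero-mean field on `T³` which is pointwise heat-stationary on `{λ₁ > 0}`
  and has `Φ_q > 0` refutes `TopEigHeatCoercivePos q` for EVERY real `q > 1` at once
  (`not_topEigHeatCoercivePos_of_dirTopEig_nonneg_on_pos`). Contrapositive — the typed DICHOTOMY:
  if `L-λ(q₀)` holds for ONE `q₀ > 1`, then EVERY smooth divergence-free zero-mean field on `T³`
  with `Φ_{q₀} > 0` has a point `x` with `λ₁(x) > 0` and `μ(S(x); ΔS(x)) < 0` — strict first-order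
  heat decay of the top strain eigenvalue along EVERY top eigenvector somewhere
  (`exists_dirTopEig_neg_of_topEigHeatCoercivePos`).
* § 4 **Every top of `λ₁` melts.** For EVERY smooth field on `T^d` (no divergence condition) and
  every LOCAL maximum point `x₀` of `λ₁`: `μ(S(x₀); ΔS(x₀)) ≤ 0`
  (`dirTopEig_laplacian_nonpos_of_isLocalMax`, `…_of_isMaxOn`). Mechanism: for a unit top
  eigenvector `e` at `x₀` the smooth scalar `φ(y) = eᵀS(y)e` satisfies `φ ≤ λ₁ ≤ λ₁(x₀) = φ(x₀)`
  near `x₀` (Rayleigh), so `x₀` is a local maximum of `φ` and `Δφ(x₀) ≤ 0` (second-derivative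
  test on the lift, Literature
  `IsLocalMax.laplacian_nonpos`), while `eᵀ ΔS(x₀) e = Δφ(x₀)` (tree
  `TopEig.quad_strainFlat_laplacian`, file `TopEigSelectionBound`). Consequence: a pointwise
  heat-stationary field is HEAT-FLAT at the top, `μ(S(x₀); ΔS(x₀)) = 0` at every maximum point of
  `λ₁` (`dirTopEig_eq_zero_at_max_of_stationary`): the maxima of `λ₁` of such a witness are
  degenerate for every `φ_e`.
* § 5 Sanity: on Laplace eigenfields `μ(S; ΔS) = −c λ₁ < 0` on `{λ₁ > 0}` — never stationary.

## Meaning for (F2) (design rules, not a decision)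

Positive Danskin mass (`μ > 0`: `λ₁` heat-INCREASING to first order along some top eigenvector)
can only live away from the maxima of `λ₁`; at the top the density is `≤ 0` for every field. An
exact witness therefore needs either exact flatness at all maxima together with `μ ≥ 0` on
`{λ₁ > 0}` (§ 3; then it kills every `q > 1` simultaneously), or a `q`-DEPENDENT cancellation
`∫ λ₁^{q−1} μ⁺ = ∫ λ₁^{q−1} μ⁻` between the melting top and heat-increasing lower levels.

HONEST LIMITS. No field satisfying the stationarity hypothesis is known and none is excluded here;
the file only types what such a field must look like. Nothing is decided about `L-λ(q)`.
FILING (prove seat g29, REQUEST #73): declarations byte-identical to the no-go seat's staged `TopEigHeatStationary.STAGING.lean` 1ee6409f64d85ac0; this line is the only addition.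
-/


noncomputable section

open MeasureTheory Set Filter Topology

namespace Summit.NavierStokesRegularity.FunctionalMining

open Literature.Analysis.FunctionSpaces Literature.Analysis.FluidPDE

namespace TopEig

variable {d : Type*} [Fintype d] [DecidableEq d] [Nonempty d]

/-! ## 1. The sign of the Danskin density -/

/-- The Danskin density `q λ₁^{q−1} μ(S; ΔS)` is non-negative at a point where `μ(S; ΔS) ≥ 0`
(`λ₁ ≥ 0` for divergence-free fields). [ours, bookkeeping] -/
theorem danskinDensity_nonneg_of_dirTopEig_nonneg {q : ℝ} (hq : 1 ≤ q)
    {v : UnitAddTorus d → EuclideanSpace ℝ d} (hv : Torus.IsSmooth v) (hdiv : Torus.IsDivFree v)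
    {x : UnitAddTorus d}
    (h : 0 ≤ dirTopEig (StrainL4.strainFlat v x) (StrainL4.strainFlat (Torus.laplacian v) x)) :
    0 ≤ q * torusStrainTopEig v x ^ (q - 1) *
      dirTopEig (StrainL4.strainFlat v x) (StrainL4.strainFlat (Torus.laplacian v) x) := by
  have hl : 0 ≤ torusStrainTopEig v x := by
    rw [← lam_strainFlat]; exact lam_strainFlat_nonneg hv hdiv x
  exact mul_nonneg (mul_nonneg (by linarith) (Real.rpow_nonneg hl _)) h

omit [Nonempty d] in
/-- For `q > 1` the Danskin density vanishes where `λ₁ = 0` (`0^{q−1} = 0`). [ours, bookkeeping] -/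
theorem danskinDensity_eq_zero_of_topEig_eq_zero {q : ℝ} (hq : 1 < q)
    {v : UnitAddTorus d → EuclideanSpace ℝ d} {x : UnitAddTorus d} (h0 : torusStrainTopEig v x = 0)
    (M : ℝ) : q * torusStrainTopEig v x ^ (q - 1) * M = 0 := by
  rw [h0, Real.zero_rpow (by linarith : q - 1 ≠ 0), mul_zero, zero_mul]

omit [DecidableEq d] [Nonempty d] in
/-- **A usable pointwise test**: if ONE unit top eigenvector `e` of `A` has `eᵀMe ≥ 0` then
`μ(A; M) ≥ 0`. [ours, bookkeeping] -/
theorem dirTopEig_nonneg_of_exists {A M : EuclideanSpace ℝ (d × d)}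
    (h : ∃ e ∈ topEigSet A, 0 ≤ quad M e) : 0 ≤ dirTopEig A M := by
  obtain ⟨e, he, h0⟩ := h
  exact h0.trans (quad_le_dirTopEig M he)

/-! ## 2. Pointwise heat-stationarity forces zero dissipation -/

/-- **Stationary everywhere ⇒ no dissipation** (`q ≥ 1`, any dimension): if `μ(S(x); ΔS(x)) ≥ 0` at
every point then `heatDissipation (∫(λ₁⁺)^q) v ≤ 0` (Danskin's formula with a non-negative density).
[ours] -/
theorem heatDissipation_topEigMoment_nonpos_of_dirTopEig_nonneg {q : ℝ} (hq : 1 ≤ q)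
    {v : UnitAddTorus d → EuclideanSpace ℝ d} (hv : Torus.IsSmooth v) (hdiv : Torus.IsDivFree v)
    (h : ∀ x, 0 ≤ dirTopEig (StrainL4.strainFlat v x) (StrainL4.strainFlat (Torus.laplacian v) x)) :
    heatDissipation (torusTopEigMoment q) v ≤ 0 := by
  rw [heatDissipation_topEigMoment_eq_integral hq hv hdiv, neg_nonpos]
  exact integral_nonneg fun x => danskinDensity_nonneg_of_dirTopEig_nonneg hq hv hdiv (h x)

/-- **Stationary on `{λ₁ > 0}` ⇒ no dissipation** (`q > 1`, any dimension): the density vanishes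
where `λ₁ = 0`, so the hypothesis is only needed on the positive set. [ours] -/
theorem heatDissipation_topEigMoment_nonpos_of_dirTopEig_nonneg_on_pos {q : ℝ} (hq : 1 < q)
    {v : UnitAddTorus d → EuclideanSpace ℝ d} (hv : Torus.IsSmooth v) (hdiv : Torus.IsDivFree v)
    (h : ∀ x, 0 < torusStrainTopEig v x →
      0 ≤ dirTopEig (StrainL4.strainFlat v x) (StrainL4.strainFlat (Torus.laplacian v) x)) :
    heatDissipation (torusTopEigMoment q) v ≤ 0 := by
  rw [heatDissipation_topEigMoment_eq_integral hq.le hv hdiv, neg_nonpos]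
  refine integral_nonneg fun x => ?_
  have hl : 0 ≤ torusStrainTopEig v x := by
    rw [← lam_strainFlat]; exact lam_strainFlat_nonneg hv hdiv x
  rcases hl.eq_or_lt with h0 | hpos
  · exact (danskinDensity_eq_zero_of_topEig_eq_zero hq h0.symm _).symm.le
  · exact danskinDensity_nonneg_of_dirTopEig_nonneg hq.le hv hdiv (h x hpos)

/-- **On `T³` the dissipation is then EXACTLY zero** (admissibility:
`heatDissipation (∫(λ₁⁺)^q) v ≥ 0` for smooth divergence-free `v`, tree
`heatDissipation_nonneg_of_admissible`). [ours] -/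
theorem heatDissipation_topEigMoment_eq_zero_of_dirTopEig_nonneg_on_pos {q : ℝ} (hq : 1 < q)
    {v : UnitAddTorus (Fin 3) → EuclideanSpace ℝ (Fin 3)} (hv : Torus.IsSmooth v)
    (hdiv : Torus.IsDivFree v)
    (h : ∀ x, 0 < torusStrainTopEig v x →
      0 ≤ dirTopEig (StrainL4.strainFlat v x) (StrainL4.strainFlat (Torus.laplacian v) x)) :
    heatDissipation (torusTopEigMoment q) v = 0 :=
  le_antisymm (heatDissipation_topEigMoment_nonpos_of_dirTopEig_nonneg_on_pos hq hv hdiv h)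
    (heatDissipation_nonneg_of_admissible hq.le convexOn_lam lipschitzWith_lam
      (fun _ hv hdiv x => lam_strainFlat_nonneg hv hdiv x)
      (fun _ hv hdiv => torusTopEigMoment_eq hv hdiv q) hv hdiv)

/-- The `q = 1`-inclusive form on `T³`: stationary EVERYWHERE ⇒
`heatDissipation (∫(λ₁⁺)^q) v = 0` for every `q ≥ 1`. [ours] -/
theorem heatDissipation_topEigMoment_eq_zero_of_dirTopEig_nonneg {q : ℝ} (hq : 1 ≤ q)
    {v : UnitAddTorus (Fin 3) → EuclideanSpace ℝ (Fin 3)} (hv : Torus.IsSmooth v)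
    (hdiv : Torus.IsDivFree v)
    (h : ∀ x, 0 ≤ dirTopEig (StrainL4.strainFlat v x) (StrainL4.strainFlat (Torus.laplacian v) x)) :
    heatDissipation (torusTopEigMoment q) v = 0 :=
  le_antisymm (heatDissipation_topEigMoment_nonpos_of_dirTopEig_nonneg hq hv hdiv h)
    (heatDissipation_nonneg_of_admissible hq convexOn_lam lipschitzWith_lam
      (fun _ hv hdiv x => lam_strainFlat_nonneg hv hdiv x)
      (fun _ hv hdiv => torusTopEigMoment_eq hv hdiv q) hv hdiv)

/-! ## 3. One stationary field kills `L-λ(q)` for every `q > 1`; the dichotomy -/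

/-- **One pointwise heat-stationary field refutes `TopEigHeatCoercivePos q` for every `q > 1` with
`Φ_q > 0`.** The stationarity hypothesis does not mention `q`. [ours] -/
theorem not_topEigHeatCoercivePos_of_dirTopEig_nonneg_on_pos
    {v : UnitAddTorus (Fin 3) → EuclideanSpace ℝ (Fin 3)} (hv : Torus.IsSmooth v)
    (hdiv : Torus.IsDivFree v) (hzm : Torus.HasZeroMean v)
    (h : ∀ x, 0 < torusStrainTopEig v x →
      0 ≤ dirTopEig (StrainL4.strainFlat v x) (StrainL4.strainFlat (Torus.laplacian v) x))
    {q : ℝ} (hq : 1 < q) (hΦ : 0 < torusTopEigMoment q v) :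
    ¬ TopEigHeatCoercivePos (d := Fin 3) q := by
  rintro ⟨c, hc, hcoer⟩
  have h1 := hcoer (by simp) v hv hdiv hzm
  rw [heatDissipation_topEigMoment_eq_zero_of_dirTopEig_nonneg_on_pos hq hv hdiv h] at h1
  nlinarith

/-- The same, quantified over `q`: ONE field, ALL `q > 1` with `Φ_q > 0`. [ours, bookkeeping] -/
theorem forall_not_topEigHeatCoercivePos_of_dirTopEig_nonneg_on_pos
    {v : UnitAddTorus (Fin 3) → EuclideanSpace ℝ (Fin 3)} (hv : Torus.IsSmooth v)
    (hdiv : Torus.IsDivFree v) (hzm : Torus.HasZeroMean v)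
    (h : ∀ x, 0 < torusStrainTopEig v x →
      0 ≤ dirTopEig (StrainL4.strainFlat v x) (StrainL4.strainFlat (Torus.laplacian v) x))
    (hΦ : ∀ q : ℝ, 1 < q → 0 < torusTopEigMoment q v) :
    ∀ q : ℝ, 1 < q → ¬ TopEigHeatCoercivePos (d := Fin 3) q :=
  fun q hq => not_topEigHeatCoercivePos_of_dirTopEig_nonneg_on_pos hv hdiv hzm h hq (hΦ q hq)

/-- **The dichotomy.** If `L-λ(q)` holds for one `q > 1`, then every smooth divergence-free
zero-mean field on `T³` with `Φ_q > 0` has a point where `λ₁ > 0` and `μ(S; ΔS) < 0`: the top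
strain eigenvalue decays strictly to first order along EVERY top eigenvector there. [ours] -/
theorem exists_dirTopEig_neg_of_topEigHeatCoercivePos {q : ℝ} (hq : 1 < q)
    (hPos : TopEigHeatCoercivePos (d := Fin 3) q)
    {v : UnitAddTorus (Fin 3) → EuclideanSpace ℝ (Fin 3)} (hv : Torus.IsSmooth v)
    (hdiv : Torus.IsDivFree v) (hzm : Torus.HasZeroMean v) (hΦ : 0 < torusTopEigMoment q v) :
    ∃ x, 0 < torusStrainTopEig v x ∧
      dirTopEig (StrainL4.strainFlat v x) (StrainL4.strainFlat (Torus.laplacian v) x) < 0 := by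
  by_contra hcon
  push Not at hcon
  exact not_topEigHeatCoercivePos_of_dirTopEig_nonneg_on_pos hv hdiv hzm hcon hq hΦ hPos

/-! ## 4. The top of `λ₁` always melts: `μ(S; ΔS) ≤ 0` at every maximum point of `λ₁` -/

omit [DecidableEq d] [Nonempty d] in
/-- **Second-derivative test on the torus**: at a LOCAL maximum point of a smooth scalar `φ`,
`Δφ ≤ 0` (the re-centred lift `w ↦ φ(x₀ + proj w)` has a local maximum at `0`; Literature
`IsLocalMax.laplacian_nonpos`). [folklore] -/
theorem laplacian_nonpos_of_isLocalMax {φ : UnitAddTorus d → ℝ} (hφ : Torus.IsSmooth φ)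
    {x₀ : UnitAddTorus d} (hmax : IsLocalMax φ x₀) : Torus.laplacian φ x₀ ≤ 0 := by
  have hW : ContDiff ℝ 2 (Torus.liftAt φ x₀) :=
    (hφ.isContDiff (n := 2) (by norm_cast)).liftAt x₀
  have hg : ContinuousAt (fun w : EuclideanSpace ℝ d => x₀ + Torus.proj w) 0 :=
    (continuous_const.add Torus.continuous_proj).continuousAt
  have hx : IsLocalMax φ ((fun w : EuclideanSpace ℝ d => x₀ + Torus.proj w) 0) := by
    show IsLocalMax φ (x₀ + Torus.proj 0)
    rwa [Torus.proj_zero, add_zero]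
  have hloc : IsLocalMax (Torus.liftAt φ x₀) 0 :=
    IsLocalMax.comp_continuous (g := fun w : EuclideanSpace ℝ d => x₀ + Torus.proj w) hx hg
  exact IsLocalMax.laplacian_nonpos hW hloc

omit [DecidableEq d] [Nonempty d] in
/-- The global form: `φ y ≤ φ x₀` for all `y` ⇒ `Δφ(x₀) ≤ 0`. [folklore] -/
theorem laplacian_nonpos_of_forall_le {φ : UnitAddTorus d → ℝ} (hφ : Torus.IsSmooth φ)
    {x₀ : UnitAddTorus d} (hmax : ∀ y, φ y ≤ φ x₀) : Torus.laplacian φ x₀ ≤ 0 :=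
  laplacian_nonpos_of_isLocalMax hφ (Filter.Eventually.of_forall hmax)

/-- **Every LOCAL top of `λ₁` melts.** For every smooth field `v` on `T^d` and every local maximum
point `x₀` of `λ₁ = torusStrainTopEig v`: `μ(S(x₀); ΔS(x₀)) ≤ 0` — along every unit top
eigenvector `e` at `x₀`, `eᵀ ΔS(x₀) e = Δ(eᵀSe)(x₀) ≤ 0` because
`eᵀS(y)e ≤ λ₁(y) ≤ λ₁(x₀) = eᵀS(x₀)e` near `x₀` makes `x₀` a local maximum of the smooth scalar
`y ↦ eᵀS(y)e`. No divergence condition is needed. [ours] -/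
theorem dirTopEig_laplacian_nonpos_of_isLocalMax {v : UnitAddTorus d → EuclideanSpace ℝ d}
    (hv : Torus.IsSmooth v) {x₀ : UnitAddTorus d} (hmax : IsLocalMax (torusStrainTopEig v) x₀) :
    dirTopEig (StrainL4.strainFlat v x₀) (StrainL4.strainFlat (Torus.laplacian v) x₀) ≤ 0 := by
  refine dirTopEig_le fun e he => ?_
  rw [quad_strainFlat_laplacian hv e x₀]
  refine laplacian_nonpos_of_isLocalMax (isSmooth_quad_strainFlat hv e) ?_
  filter_upwards [hmax] with y hy
  calc quad (StrainL4.strainFlat v y) e ≤ lam (StrainL4.strainFlat v y) := quad_le_lam _ he.1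
    _ = torusStrainTopEig v y := lam_strainFlat v y
    _ ≤ torusStrainTopEig v x₀ := hy
    _ = lam (StrainL4.strainFlat v x₀) := (lam_strainFlat v x₀).symm
    _ = quad (StrainL4.strainFlat v x₀) e := he.2.symm

/-- **The global top of `λ₁` melts**: `μ(S(x₀); ΔS(x₀)) ≤ 0` at every maximum point `x₀` of `λ₁`.
[ours] -/
theorem dirTopEig_laplacian_nonpos_of_isMaxOn {v : UnitAddTorus d → EuclideanSpace ℝ d}
    (hv : Torus.IsSmooth v) {x₀ : UnitAddTorus d} (hmax : IsMaxOn (torusStrainTopEig v) univ x₀) :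
    dirTopEig (StrainL4.strainFlat v x₀) (StrainL4.strainFlat (Torus.laplacian v) x₀) ≤ 0 :=
  dirTopEig_laplacian_nonpos_of_isLocalMax hv (hmax.isLocalMax Filter.univ_mem)

/-- `λ₁` attains its maximum on the compact torus. [folklore] -/
theorem exists_isMaxOn_torusStrainTopEig {v : UnitAddTorus d → EuclideanSpace ℝ d}
    (hv : Torus.IsSmooth v) : ∃ x₀, IsMaxOn (torusStrainTopEig v) univ x₀ := by
  obtain ⟨x₀, _, h⟩ := isCompact_univ.exists_isMaxOn univ_nonempty
    (continuous_torusStrainTopEig hv).continuousOn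
  exact ⟨x₀, h⟩

/-- **Every smooth field has a point of first-order heat decay (or flatness) at the top**:
`∃ x₀, (∀ y, λ₁(y) ≤ λ₁(x₀)) ∧ μ(S(x₀); ΔS(x₀)) ≤ 0`. [ours] -/
theorem exists_isMaxOn_dirTopEig_laplacian_nonpos {v : UnitAddTorus d → EuclideanSpace ℝ d}
    (hv : Torus.IsSmooth v) : ∃ x₀, IsMaxOn (torusStrainTopEig v) univ x₀ ∧
      dirTopEig (StrainL4.strainFlat v x₀) (StrainL4.strainFlat (Torus.laplacian v) x₀) ≤ 0 := by
  obtain ⟨x₀, h⟩ := exists_isMaxOn_torusStrainTopEig hv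
  exact ⟨x₀, h, dirTopEig_laplacian_nonpos_of_isMaxOn hv h⟩

/-- **A pointwise heat-stationary field is heat-FLAT at the top**: under the stationarity
hypothesis of § 3, `μ(S(x₀); ΔS(x₀)) = 0` at every maximum point `x₀` of `λ₁` with `λ₁(x₀) > 0`.
[ours] -/
theorem dirTopEig_eq_zero_at_max_of_stationary {v : UnitAddTorus d → EuclideanSpace ℝ d}
    (hv : Torus.IsSmooth v)
    (h : ∀ x, 0 < torusStrainTopEig v x →
      0 ≤ dirTopEig (StrainL4.strainFlat v x) (StrainL4.strainFlat (Torus.laplacian v) x))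
    {x₀ : UnitAddTorus d} (hmax : IsMaxOn (torusStrainTopEig v) univ x₀)
    (hpos : 0 < torusStrainTopEig v x₀) :
    dirTopEig (StrainL4.strainFlat v x₀) (StrainL4.strainFlat (Torus.laplacian v) x₀) = 0 :=
  le_antisymm (dirTopEig_laplacian_nonpos_of_isMaxOn hv hmax) (h x₀ hpos)

omit [Nonempty d] in
/-- If `λ₁ > 0` somewhere then `λ₁ > 0` at every maximum point. [ours, bookkeeping] -/
theorem torusStrainTopEig_pos_at_max {v : UnitAddTorus d → EuclideanSpace ℝ d}
    {x₀ x₁ : UnitAddTorus d} (hmax : IsMaxOn (torusStrainTopEig v) univ x₀)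
    (hx₁ : 0 < torusStrainTopEig v x₁) :
    0 < torusStrainTopEig v x₀ :=
  hx₁.trans_le (hmax (mem_univ x₁))

/-! ## 5. Sanity: Laplace eigenfields are never stationary (`μ(S; ΔS) = −c λ₁`) -/

/-- On a Laplace eigenfield `Δv = −c v` the Danskin direction is its own ray:
`μ(S(x); ΔS(x)) = −c λ₁(x)` (tree `dirTopEig_smul_self`; consistent with the tree calibration
`heatDissipation = q c Φ_q`). [ours, bookkeeping] -/
theorem dirTopEig_laplacian_of_laplacian_eq {v : UnitAddTorus d → EuclideanSpace ℝ d}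
    (hv : Torus.IsSmooth v) {c : ℝ} (hΔ : Torus.laplacian v = -(c • v)) (x : UnitAddTorus d) :
    dirTopEig (StrainL4.strainFlat v x) (StrainL4.strainFlat (Torus.laplacian v) x) =
      -c * torusStrainTopEig v x := by
  rw [hΔ, ← neg_smul, strainFlat_smul (hv.isContDiff (by simp)) (-c) x, dirTopEig_smul_self,
    lam_strainFlat]

/-- Hence a Laplace eigenfield with `c > 0` decays strictly to first order wherever `λ₁ > 0`: it is
never pointwise heat-stationary, in line with the dichotomy of § 3 (single shells are coercive with
the rate `q c`). [ours, bookkeeping] -/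
theorem dirTopEig_laplacian_neg_of_laplacian_eq {v : UnitAddTorus d → EuclideanSpace ℝ d}
    (hv : Torus.IsSmooth v) {c : ℝ} (hc : 0 < c) (hΔ : Torus.laplacian v = -(c • v))
    {x : UnitAddTorus d} (hx : 0 < torusStrainTopEig v x) :
    dirTopEig (StrainL4.strainFlat v x) (StrainL4.strainFlat (Torus.laplacian v) x) < 0 := by
  rw [dirTopEig_laplacian_of_laplacian_eq hv hΔ x, neg_mul, neg_lt_zero]
  exact mul_pos hc hx

end TopEig

end Summit.NavierStokesRegularity.FunctionalMining

end

-- search for candidate a priori estimates; no regularity claim
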